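import Literature.MathematicalPhysics.QuantumLattice.HubbardScaleZeroSectorSymbolRadialLine
import Literature.MathematicalPhysics.QuantumLattice.SectorAngularLineNamedConstants
import Literature.MathematicalPhysics.QuantumLattice.TorusCentredMomentumLines
import Literature.MathematicalPhysics.QuantumLattice.AnisotropicSectors
import Literature.Analysis.Calculus.SecondDifferenceProductBound
import HarnessLib

/-!
# The padded scale-`0` sector multiplier: the second SPACE differences along the lattice directions

Topic `MathematicalPhysics/QuantumLattice`; completes the symbol layer of the sector-function `L¹` size `b₀` of the K3 engine's scale-`0` step
(`HubbardScaleZeroSectorSymbolTime`: sup, support, TIME differences; `HubbardScaleZeroSectorSymbolRadialLine`: the radial factor along a band path;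
`SectorAngularLineNamedConstants`: the angular factor along lines, named constants; `TorusCentredMomentumLines`: no-wrap / wrap geometry;
`SecondDifferenceProductBound`: `|Δ²(fg)| ≤ δ²(F₂G₀ + 2F₁G₁ + F₀G₂)`).  Along a lattice line `q⃗ + m e_l` the padded multiplier
`G_ω(q₀, ·)` is `R(mδ)·A(mδ)`, `δ = 2π/L`, with the radial factor `R(t) = H₀(√(ω̃² + e_K(p + t e_l)²))` (`|R′| ≤ (8/(3e₀))D`,
`|R″| ≤ (448/(9e₀²))D² + (8/(3e₀))D` under `UVLineBound μ K D`) and the angular factor `A(t) = ζ̃_{0,ω}(θ(c⃗ + t e_l))` through the CENTRED momentum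
(`|A′| ≤ B·3/r₀`, `|A″| ≤ B·(3/r₀)²` on `‖c⃗ + t e_l‖ ≥ r₀`, `B = sectorCircLineConst`) — provided the centred coordinate does not wrap; if it wraps,
all three sample points lie within `4π/L` of the zone boundary, where (hypothesis `hzone`) the band exceeds `e₀` and the multiplier vanishes.

* `cutoffFreqFn_symm`, `sectorRelAngle_polarAngle_self`, `norm_momToComplex_single`;
* **`norm_fwdDiff_two_space_bgmGridSymbol_le`** — for every `q₀, q⃗, l`:
  `‖(Δ_{e_l})² G_ω(q₀, ·)(q⃗)‖ ≤ (2π/L)²·(F₂ + 2F₁·B(3/r₀) + B(3/r₀)²)`, `r₀ = r₁ − 4π/L`, under `UVLineBound μ K D`, the zone hypothesis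
  `hzone` and the shell-radius hypothesis `hr` (`|e_K(k⃗)| < e₀ ⇒ ‖c⃗(k⃗)‖ ≥ r₁ > 4π/L`), both discharged Summits-side from the chemical-potential window;
* `norm_fwdDiff_two_space_bgmGridSymbol_prod_le` — the same on the product torus with the step `(0, e_l)`.

Everything is proved; no definitions, no named facts.

## Sources

G. Benfatto, A. Giuliani, V. Mastropietro, Ann. Henri Poincaré 7 (2006) 809–898, §2.5 (2.45)–(2.48), Lemma 2.2, (2.36aa)
[`BenfattoGiulianiMastropietro2006`].
-/

noncomputable section

namespace Literature.MathematicalPhysics.QuantumLattice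

open Literature.Probability.LatticeModels Real Set Complex

/-! ### Small facts -/

/-- `φ` is symmetric in the frequency and the band: `H₀(√(ν² + e²)) = H₀(√(e² + ν²))`. [cite: BenfattoGiulianiMastropietro2006, §2.3 (2.19)] -/
theorem cutoffFreqFn_symm (e₀ e ν : ℝ) : cutoffFreqFn e₀ e ν = cutoffFreqFn e₀ ν e := by
  simp only [cutoffFreqFn, add_comm]

/-- The relative angle of a nonzero momentum with respect to its own polar angle vanishes. [cite: BenfattoGiulianiMastropietro2006, §2.5 (2.45)] -/
theorem sectorRelAngle_polarAngle_self {k : Fin 2 → ℝ} (hk : k ≠ 0) : sectorRelAngle (polarAngle k) k = 0 := by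
  have hz : momToComplex k ≠ 0 := fun h => hk ((momToComplex_eq_zero_iff k).1 h)
  rw [sectorRelAngle, polarAngle]
  set z := momToComplex k with hzdef
  have h : z * exp (-(arg z * I)) = (‖z‖ : ℂ) := by
    calc z * exp (-(arg z * I)) = (‖z‖ : ℂ) * exp (arg z * I) * exp (-(arg z * I)) := by rw [norm_mul_exp_arg_mul_I z]
      _ = (‖z‖ : ℂ) * (exp (arg z * I) * exp (-(arg z * I))) := by ring
      _ = (‖z‖ : ℂ) := by rw [← Complex.exp_add, add_neg_cancel, Complex.exp_zero, mul_one]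
  rw [h, arg_ofReal_of_nonneg (norm_nonneg _)]

/-- `‖e_l‖ = 1` in the complex picture. [folklore] -/
private theorem norm_momToComplex_single (l : Fin 2) : ‖momToComplex (Pi.single l (1 : ℝ) : Fin 2 → ℝ)‖ = 1 := by
  rw [Complex.norm_eq_sqrt_sq_add_sq, momToComplex_re, momToComplex_im]
  fin_cases l <;> simp

/-! ### The second space differences -/

section Space

variable {L M N : ℕ} [NeZero L]

/-- **The second SPACE difference of the padded scale-`0` multiplier, every point** (`0 < e₀`, `8 < L`, `UVLineBound μ K D`, the zone and
shell-radius hypotheses): `‖(Δ_{e_l})² G_ω(q₀,·)(q⃗)‖ ≤ (2π/L)²·(F₂ + 2F₁G₁ + G₂)` with `F₁ = (8/(3e₀))D`, `F₂ = (448/(9e₀²))D² + (8/(3e₀))D`,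
`G_i = sectorCircLineConst·(3/(r₁ − 4π/L))ⁱ`. [cite: BenfattoGiulianiMastropietro2006, (2.36aa)] -/
theorem norm_fwdDiff_two_space_bgmGridSymbol_le {e₀ β μ D r₁ : ℝ} {K : TrigPolyC4v} (he : 0 < e₀) (hL : 8 < L)
    (hD : UVLineBound μ K D) (l : Fin 2)
    (hzone : ∀ k : TorusSite 2 L, |2 * (((k l).val : ℤ)) - L| ≤ 4 → e₀ ≤ |nambuXiCT L μ K k|)
    (hr : ∀ k : TorusSite 2 L, |nambuXiCT L μ K k| < e₀ → r₁ ≤ ‖momToComplex (torusCentredMomentum L k)‖)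
    (hr₁ : 4 * π / L < r₁) (ω : Fin (sectorCount 0)) (q₀ : TorusSite 1 N) (qv : TorusSite 2 L) :
    ‖(fwdDiff (Pi.single l (1 : ZMod L) : TorusSite 2 L))^[2] (bgmGridSymbol L M N e₀ β μ K ω q₀) qv‖ ≤
      (2 * π / L) ^ 2 * ((448 / (9 * e₀ ^ 2) * D ^ 2 + 8 / (3 * e₀) * D) +
        2 * (8 / (3 * e₀) * D) * (sectorCircLineConst * (3 / (r₁ - 4 * π / L))) +
          sectorCircLineConst * (3 / (r₁ - 4 * π / L)) ^ 2) := by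
  have hL0 : (0 : ℝ) < L := by exact_mod_cast (show 0 < L by omega)
  set E : TorusSite 2 L := (Pi.single l (1 : ZMod L) : TorusSite 2 L) with hE
  set δ : ℝ := 2 * π / L with hδ
  have hδ0 : 0 ≤ δ := by positivity
  set r₀ : ℝ := r₁ - 4 * π / L with hr₀def
  have hr₀ : 0 < r₀ := by rw [hr₀def]; linarith
  have hB := sectorCircLineConst_nonneg
  have hRHS : 0 ≤ (2 * π / L) ^ 2 * ((448 / (9 * e₀ ^ 2) * D ^ 2 + 8 / (3 * e₀) * D) +
      2 * (8 / (3 * e₀) * D) * (sectorCircLineConst * (3 / (r₁ - 4 * π / L))) +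
        sectorCircLineConst * (3 / (r₁ - 4 * π / L)) ^ 2) := by
    obtain ⟨e', e'', _, _, hb⟩ := hD (latticeMomentum L qv) l
    have hD0 : 0 ≤ D := (abs_nonneg _).trans (hb 0).1
    rw [← hr₀def]
    positivity
  rw [fwdDiff_iter_two_apply]
  -- padding
  by_cases hq0 : (q₀ 0).val < 2 * M
  swap
  · have hz : ∀ k, bgmGridSymbol L M N e₀ β μ K ω q₀ k = 0 := fun k => by unfold bgmGridSymbol; rw [dif_neg hq0]
    rw [hz, hz, hz]; simpa using hRHS
  -- are all three values zero?
  by_cases hex : ∃ m₀ : ℕ, m₀ ≤ 2 ∧ bgmGridSymbol L M N e₀ β μ K ω q₀ (qv + m₀ • E) ≠ 0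
  swap
  · have hz : ∀ m : ℕ, m ≤ 2 → bgmGridSymbol L M N e₀ β μ K ω q₀ (qv + m • E) = 0 := fun m hm => by
      by_contra h
      exact hex ⟨m, hm, h⟩
    have h0 := hz 0 (by norm_num)
    rw [zero_smul, add_zero] at h0
    rw [hz 2 le_rfl, hz 1 (by norm_num), h0]
    simpa using hRHS
  obtain ⟨m₀, hm₀, hne⟩ := hex
  -- the supported point is inside the shell, hence off the boundary strip: no wrap
  have hband : |nambuXiCT L μ K (qv + m₀ • E)| < e₀ := by
    by_contra h
    exact hne (bgmGridSymbol_eq_zero_of_le_abs_band he β μ K ω q₀ (not_lt.1 h))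
  have hnowrap : ((qv l).valMinAbs + 2) * 2 ≤ (L : ℤ) := by
    by_contra h
    have hw := abs_two_mul_val_sub_le_of_wrap qv l (m := 2) le_rfl hL (not_le.1 h) m₀ hm₀
    exact absurd (hzone _ hw) (not_le.2 hband)
  have hnw : ∀ m' : ℕ, m' ≤ 2 → ((qv l).valMinAbs + m') * 2 ≤ (L : ℤ) := fun m' hm' => by
    have : (m' : ℤ) ≤ 2 := by exact_mod_cast hm'
    linarith
  -- the objects
  set p : Fin 2 → ℝ := latticeMomentum L qv with hp
  set c : Fin 2 → ℝ := torusCentredMomentum L qv with hc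
  set e : Fin 2 → ℝ := (Pi.single l (1 : ℝ) : Fin 2 → ℝ) with hedef
  set ν : ℝ := gridFreq M N β q₀ with hν
  obtain ⟨e', e'', hd, hd', hb⟩ := hD p l
  have hD0 : 0 ≤ D := (abs_nonneg _).trans (hb 0).1
  set R : ℝ → ℝ := cutoffBandPathFn e₀ ν (ctLine μ K p l) with hR
  set A : ℝ → ℝ := fun t => sectorWeightCirc 0 ((ω : ℕ) : ℤ) (polarAngle (c + t • e)) with hA
  -- the three values
  have hval : ∀ m' : ℕ, m' ≤ 2 → bgmGridSymbol L M N e₀ β μ K ω q₀ (qv + m' • E) = (((R (m' * δ) * A (m' * δ) : ℝ)) : ℂ) := by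
    intro m' hm'
    rw [bgmGridSymbol_eq, if_pos hq0, hE, nambuXiCT_add_smul_single_eq_ctLine μ K qv l m', momentumAngle_add_smul_single qv l m' (hnw m' hm'),
      cutoffFreqFn_symm]
    simp only [hR, hA, cutoffBandPathFn, hp, hc, hedef, hν, hδ]
  have h0 := hval 0 (by norm_num)
  rw [zero_smul, add_zero] at h0
  rw [hval 2 le_rfl, hval 1 (by norm_num), h0]
  -- as a real second difference
  have hreal : (((R ((2 : ℕ) * δ) * A ((2 : ℕ) * δ) : ℝ)) : ℂ) - (2 : ℤ) • (((R ((1 : ℕ) * δ) * A ((1 : ℕ) * δ) : ℝ)) : ℂ) +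
      (((R ((0 : ℕ) * δ) * A ((0 : ℕ) * δ) : ℝ)) : ℂ) =
      (((R (0 + 2 * δ) * A (0 + 2 * δ) - 2 * (R (0 + δ) * A (0 + δ)) + R 0 * A 0 : ℝ)) : ℂ) := by
    simp only [zsmul_eq_mul, Int.cast_ofNat, Nat.cast_ofNat, Nat.cast_one, Nat.cast_zero, one_mul, zero_mul, zero_add]
    push_cast
    ring
  rw [hreal, Complex.norm_real, Real.norm_eq_abs]
  -- radius along the segment
  have hrad : ∀ t ∈ Icc (0 : ℝ) (0 + 2 * δ), r₀ ≤ ‖momToComplex (c + t • e)‖ := by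
    intro t ht
    rw [zero_add] at ht
    have hm₀c : torusCentredMomentum L (qv + m₀ • E) = c + ((m₀ : ℝ) * δ) • e := by
      rw [hE, torusCentredMomentum_add_smul_single qv l m₀ (hnw m₀ hm₀)]
    have h1 : r₁ ≤ ‖momToComplex (c + ((m₀ : ℝ) * δ) • e)‖ := by rw [← hm₀c]; exact hr _ hband
    have hdiff : momToComplex (c + t • e) - momToComplex (c + ((m₀ : ℝ) * δ) • e) = ((t - m₀ * δ : ℝ) : ℂ) * momToComplex e := by
      rw [momToComplex_add_smul, momToComplex_add_smul]
      push_cast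
      ring
    have hnd : ‖momToComplex (c + t • e) - momToComplex (c + ((m₀ : ℝ) * δ) • e)‖ ≤ 2 * δ := by
      rw [hdiff, norm_mul, hedef, norm_momToComplex_single, mul_one, Complex.norm_real, Real.norm_eq_abs, abs_le]
      have : (m₀ : ℝ) ≤ 2 := by exact_mod_cast hm₀
      have : (0 : ℝ) ≤ m₀ := by positivity
      constructor <;> nlinarith [ht.1, ht.2]
    have := norm_sub_norm_le (momToComplex (c + ((m₀ : ℝ) * δ) • e)) (momToComplex (c + t • e))
    rw [norm_sub_rev] at this
    rw [hr₀def]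
    have h4 : 4 * π / L = 2 * δ := by rw [hδ]; ring
    linarith
  have hne0 : ∀ t ∈ Icc (0 : ℝ) (0 + 2 * δ), c + t • e ≠ 0 := by
    intro t ht h0
    have := hrad t ht
    rw [h0, (momToComplex_eq_zero_iff 0).2 rfl, norm_zero] at this
    exact absurd this (not_le.2 hr₀)
  -- smoothness of the angular factor on the open set `U = {t | c + t e ≠ 0}`
  set U : Set ℝ := {t | c + t • e ≠ 0} with hU
  have hUo : IsOpen U := isOpen_ne_fun (continuous_const.add (continuous_id.smul continuous_const)) continuous_const
  have hAon : ContDiffOn ℝ ((⊤ : ℕ∞) : WithTop ℕ∞) A U := fun t ht =>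
    ((contDiffAt_sectorWeightCirc_polarAngle 0 ((ω : ℕ) : ℤ) ht).comp t
      (contDiff_const.add (contDiff_id.smul contDiff_const)).contDiffAt).contDiffWithinAt
  obtain ⟨hA1, hA2⟩ := (contDiffOn_infty_iff_deriv_of_isOpen hUo).1 hAon
  obtain ⟨hA3, _⟩ := (contDiffOn_infty_iff_deriv_of_isOpen hUo).1 hA2
  have hAd : ∀ t ∈ Icc (0 : ℝ) (0 + 2 * δ), HasDerivAt A (deriv A t) t := fun t ht =>
    ((hA1 t (hne0 t ht)).differentiableAt (hUo.mem_nhds (hne0 t ht))).hasDerivAt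
  have hAd' : ∀ t ∈ Icc (0 : ℝ) (0 + 2 * δ), HasDerivAt (deriv A) (deriv (deriv A) t) t := fun t ht =>
    ((hA3 t (hne0 t ht)).differentiableAt (hUo.mem_nhds (hne0 t ht))).hasDerivAt
  -- angular bounds from the named line constant
  have hΘ : ∀ t ∈ Icc (0 : ℝ) (0 + 2 * δ), |sectorRelAngle (polarAngle (c + t • e)) (c + t • e)| < π := fun t ht => by
    rw [sectorRelAngle_polarAngle_self (hne0 t ht), abs_zero]; exact pi_pos
  have hG1 : ∀ t ∈ Icc (0 : ℝ) (0 + 2 * δ), |deriv A t| ≤ sectorCircLineConst * (3 / r₀) := by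
    intro t ht
    have h := norm_iteratedDeriv_sectorWeightCirc_zero_line_le (i := 1) (by norm_num) ((ω : ℕ) : ℤ) (polarAngle (c + t • e)) c e t hr₀
      (hrad t ht) (hΘ t ht)
    rw [iteratedDeriv_one, Real.norm_eq_abs, pow_one, hedef, norm_momToComplex_single, mul_one] at h
    simpa [hA, hedef] using h
  have hG2 : ∀ t ∈ Icc (0 : ℝ) (0 + 2 * δ), |deriv (deriv A) t| ≤ sectorCircLineConst * (3 / r₀) ^ 2 := by
    intro t ht
    have h := norm_iteratedDeriv_sectorWeightCirc_zero_line_le (i := 2) le_rfl ((ω : ℕ) : ℤ) (polarAngle (c + t • e)) c e t hr₀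
      (hrad t ht) (hΘ t ht)
    rw [iteratedDeriv_succ, iteratedDeriv_one, Real.norm_eq_abs, hedef, norm_momToComplex_single, mul_one] at h
    simpa [hA, hedef] using h
  have hG0 : ∀ t ∈ Icc (0 : ℝ) (0 + 2 * δ), |A t| ≤ 1 := fun t _ => by
    rw [hA, abs_of_nonneg (sectorWeightCirc_nonneg 0 _ _)]; exact sectorWeightCirc_le_one 0 _ _
  -- radial bounds
  have hRb := fun t => cutoffBandPathFn_bounds he ν hd hd' hb t
  -- mean value twice on the product
  have hmv := Literature.Analysis.abs_second_difference_mul_le (x := 0) (δ := δ)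
    (f := R) (f' := cutoffBandPathFnD1 e₀ ν (ctLine μ K p l) e') (f'' := cutoffBandPathFnD2 e₀ ν (ctLine μ K p l) e' e'')
    (g := A) (g' := deriv A) (g'' := deriv (deriv A))
    (F₀ := 1) (F₁ := 8 / (3 * e₀) * D) (F₂ := 448 / (9 * e₀ ^ 2) * D ^ 2 + 8 / (3 * e₀) * D)
    (G₀ := 1) (G₁ := sectorCircLineConst * (3 / r₀)) (G₂ := sectorCircLineConst * (3 / r₀) ^ 2) hδ0
    (fun t _ => (hRb t).1) (fun t _ => (hRb t).2.1) hAd hAd'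
    (fun t _ => abs_cutoffBandPathFn_le_one e₀ ν _ t) (fun t _ => (hRb t).2.2.1) (fun t _ => (hRb t).2.2.2) hG0 hG1 hG2
  refine hmv.trans (le_of_eq ?_)
  rw [hδ, hr₀def]
  ring

/-- The same difference written on the product torus with the step `(0, e_l)` (the form of `sum_norm_charSum_le_of_second_differences`).
[cite: BenfattoGiulianiMastropietro2006, (2.36aa)] -/
theorem norm_fwdDiff_two_space_bgmGridSymbol_prod_le {e₀ β μ D r₁ : ℝ} {K : TrigPolyC4v} (he : 0 < e₀) (hL : 8 < L)
    (hD : UVLineBound μ K D) (l : Fin 2)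
    (hzone : ∀ k : TorusSite 2 L, |2 * (((k l).val : ℤ)) - L| ≤ 4 → e₀ ≤ |nambuXiCT L μ K k|)
    (hr : ∀ k : TorusSite 2 L, |nambuXiCT L μ K k| < e₀ → r₁ ≤ ‖momToComplex (torusCentredMomentum L k)‖)
    (hr₁ : 4 * π / L < r₁) (ω : Fin (sectorCount 0)) (q : TorusSite 1 N × TorusSite 2 L) :
    ‖(fwdDiff ((0 : TorusSite 1 N), (Pi.single l (1 : ZMod L) : TorusSite 2 L)))^[2]
        (fun q : TorusSite 1 N × TorusSite 2 L => bgmGridSymbol L M N e₀ β μ K ω q.1 q.2) q‖ ≤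
      (2 * π / L) ^ 2 * ((448 / (9 * e₀ ^ 2) * D ^ 2 + 8 / (3 * e₀) * D) +
        2 * (8 / (3 * e₀) * D) * (sectorCircLineConst * (3 / (r₁ - 4 * π / L))) +
          sectorCircLineConst * (3 / (r₁ - 4 * π / L)) ^ 2) := by
  have h := norm_fwdDiff_two_space_bgmGridSymbol_le (M := M) (N := N) (β := β) he hL hD l hzone hr hr₁ ω q.1 q.2
  rw [fwdDiff_iter_two_apply] at h ⊢
  simpa [Prod.smul_mk, Prod.fst_add, Prod.snd_add] using h

end Space

end Literature.MathematicalPhysics.QuantumLattice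

end
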